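import Summits.QuantumFields.YangMills.Theorems.BalabanLadderIRPurityClimb24
import Summits.QuantumFields.YangMills.Theorems.BalabanLadderIRCouplingAxisTransport
import HarnessLib

/-!
# Pinned exit at 96 % — the E- and H-bills for `BalabanLadder.IR` RE-BASED TO FLOOR UNITS at one tolerance
# (`PinnedExitAt (1/24) → IRnsc → IR`, no asymptotic-freedom pin), and `FloorToPurityAt (1/24) ↔ FloorToPuritySC`

Helper theorems for crux `Summit.QuantumFields.YangMills.Theses.BalabanLadder.IR` (stmt-QuantumFields-19354), landed from the crux
workfile `Cruxes/IR/Lines/pinned_exit_96.lean` (ideator seat ym-ir-idea-14 gen 2, LINE B «pinned-exit-96»; critics ym-ir-crit-2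
VERDICT 17 06:07Z «PASS as FORMAT / RE-BASE, land the seams in the g9-№2 lane», ym-ir-crit-1 06:10Z «PASS-WITH-PRICE width 0,
bankable as the X-free bill PX ∧ N → IR»).  SORRY-FREE.

HONESTY: nothing in this file proves the Clay Yang–Mills mass gap, a lattice gap, an exit, or `BalabanLadder.IR`; `R4`
(`BalabanUVStability4`) closes only the conditional finite-𝕋⁴ rung `BalabanLadder.UV`.  This file discharges NO Yang–Mills content: it
re-types the bills of record in floor units (count-neutral).  The open statement is `PinnedExitAt (1/24)` (XL, no printed weak-coupling
tool) together with the residual `IRnsc`.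

## Content
* §1 `PinnedExitAt θ` («PX»): under the crux's own hypotheses (`a > 0`, `a → 0`, `LowerBounds G r a`) there are `T, β₁` with: for every
  `β ≥ β₁` SOME cold `4:1` torus of lattice side `L ∈ [8, T/a(β)]` has `coldDefect ≤ θ`.  `FloorToPurityAt θ`: the handshake
  `ColdPurityBridge.FloorToPuritySC` with the purity tolerance fixed at `θ`.
* §2 `coldPressureAt_widen_24` (96 %-pure cold box at `L` ⇒ `ColdPressureAt` at `2¹⁴·L`, via the landed `PurityClimb.coldDefect_widen_24`,
  `AspectBootstrap.coldDefect_sq_le_two_pow`, `ColdPurityBridge.coldPressureAt_of_exit_recursion`); `irsc_of_pinnedExit24 :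
  PinnedExitAt (1/24) → IRsc` (explicit scale factor keeps the pin: `cpLength_le` + `gapInUnits_of_coldPressure_pinned`); the bill
  `IR_of : PinnedExitAt (1/24) → IRnsc → BalabanLadder.IR` BY NAME.
* §3 `pinnedExit_of_floorToPurityAt : FloorToPurityAt θ → PinnedExitAt θ`; `coldDefect_window_exp` (96 % at `L` ⇒ `exp (−m)` at
  `m·2¹⁴·L`, via `CouplingAxis.decay_of_exit`); `floorToPuritySC_of_at24`, `rebaseH_iff : FloorToPurityAt (1/24) ↔ FloorToPuritySC`;
  `IR_of_H24 : FloorToPurityAt (1/24) → IRnsc → BalabanLadder.IR`.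
* Not claimed: `ColdExitAt (1/24) ∧ AFToColdPressure ⇒ PinnedExitAt (1/24)` (the pincer's `ColdPressureAt` constants are β-dependent).
-/

noncomputable section

open MeasureTheory Filter Topology
open scoped SchwartzMap
open Literature.MathematicalPhysics.QuantumFieldTheory Literature.MathematicalPhysics.QuantumLattice
open Summit.QuantumFields.YangMills.Cruxes.OSLegsFromFemtoAndGap.DlrCollarTransfer (GapInUnits LowerBounds Q2)
open Summit.QuantumFields.YangMills.Cruxes.IR.ColdPressurePincer
open Summit.QuantumFields.YangMills.Cruxes.IR.ColdPurityBridge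
open Summit.QuantumFields.YangMills.Cruxes.IR.AspectBootstrap
open Summit.QuantumFields.YangMills.Cruxes.IR.BasinRung
open Summit.QuantumFields.YangMills.Cruxes.IR.PurityClimb (coldDefect_widen_24)
open Summit.QuantumFields.YangMills.Cruxes.IR.CouplingAxis (decay_of_exit)

namespace Summit.QuantumFields.YangMills.Cruxes.IR.PinnedExit96

/-! ## §1 Statements -/

/-- **PX_θ = `PinnedExitAt θ`** (registered at `θ = 1/24`).  Under the crux's own hypotheses on the floor scale `a` — positivity,
`a → 0`, and the observable floors `LowerBounds G r a` — there are a pin `T` and a threshold `β₁` such that every `β ≥ β₁` has SOME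
cold `4:1` torus of lattice side `L ≥ 8` with `a(β)·L ≤ T` (at most `T` floor-lengths) and cold purity defect `δᶜ_β(L) ≤ θ`.
Conditional in the way `IR` is (the floor is a hypothesis); simply-connected compact simple `G`. -/
def PinnedExitAt (θ : ℝ) : Prop :=
  ∀ (G : Type) [Group G] [TopologicalSpace G] [IsTopologicalGroup G] [CompactSpace G],
    IsCompactSimpleLieGroup G → SimplyConnectedSpace G →
    letI : MeasurableSpace G := borel G
    haveI : BorelSpace G := ⟨rfl⟩
    ∀ (r : LatticeRep G) (a : ℝ → ℝ), (∀ β, 0 < a β) → Tendsto a atTop (𝓝 0) → LowerBounds G r a →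
      ∃ T β₁ : ℝ, ∀ β : ℝ, β₁ ≤ β → ∃ L : ℕ, 8 ≤ L ∧ a β * (L : ℝ) ≤ T ∧ coldDefect r.ρ β L ≤ θ

/-- The registered instance **PX** := `PinnedExitAt (1/24)` (decl `PinnedExitSC`). -/
def PinnedExitSC : Prop := PinnedExitAt (1 / 24)

/-- **H_θ = `FloorToPurityAt θ`** — the handshake H (`ColdPurityBridge.FloorToPuritySC`) with the purity tolerance FIXED at `θ` instead of
quantified (`∀ ε₀ > 0`): an observable floor at spacing `s ≤ s₀` forces a `θ`-pure cold torus with side in the window `[1/s, k/s]`. -/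
def FloorToPurityAt (θ : ℝ) : Prop :=
  ∀ (G : Type) [Group G] [TopologicalSpace G] [IsTopologicalGroup G] [CompactSpace G],
    IsCompactSimpleLieGroup G → SimplyConnectedSpace G →
    letI : MeasurableSpace G := borel G
    haveI : BorelSpace G := ⟨rfl⟩
    ∀ (r : LatticeRep G) (v : 𝓢(EuclideanSpace ℝ (Fin 4), ℝ)),
      tsupport v ⊆ {y : EuclideanSpace ℝ (Fin 4) | 0 < y 0} →
      ∀ (ε Λ : ℝ), 0 < ε →
        ∃ (β₀ s₀ k : ℝ), 0 < s₀ ∧ ∀ β : ℝ, β₀ ≤ β → ∀ s : ℝ, 0 < s → s ≤ s₀ →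
          (∀ L : ℕ, Λ ≤ s * L → ε ≤ Q2 G r β L s (thetaTest 4 v) v) →
            ∃ L' : ℕ, 8 ≤ L' ∧ 1 / s ≤ (L' : ℝ) ∧ (L' : ℝ) ≤ k / s ∧ coldDefect r.ρ β L' ≤ θ

/-- The registered H-side instance **H₂₄** := `FloorToPurityAt (1/24)` (decl `FloorToPurity24`). -/
def FloorToPurity24 : Prop := FloorToPurityAt (1 / 24)

/-! ## §2 PX ⇒ IRsc ⇒ (with N) IR — PROVED, no AF pin -/

section Model

variable {G : Type} [Group G] [TopologicalSpace G] [IsTopologicalGroup G] [CompactSpace G]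
  [MeasurableSpace G] [BorelSpace G]

/-- **Cold pressure from a 96 %-pure box, at an EXPLICITLY widened scale (PROVED).**  `β ≥ 0`, `L ≥ 8`, `δᶜ_β(L) ≤ 1/24` ⇒
`ColdPressureAt r.ρ β (2¹⁴·L)`: the landed climb `coldDefect_widen_24` gives `δᶜ_β(2¹⁴L) ≤ 2⁻²⁵ ≤ 2⁻²⁴ = 1/(16·max 2²⁰ 2)`, and the landed
sharp recursion (`C = 2²⁰`, all `L ≥ 8`) feeds the seam `coldPressureAt_of_exit_recursion` at the widened box itself. -/
theorem coldPressureAt_widen_24 (r : LatticeRep G) {β : ℝ} (hβ0 : 0 ≤ β) {L : ℕ} (hL : 8 ≤ L)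
    (hδ : coldDefect r.ρ β L ≤ 1 / 24) : ColdPressureAt r.ρ β (16384 * L) := by
  have h25 := coldDefect_widen_24 r hβ0 L hL hδ
  have hrec : ∀ M : ℕ, 8 ≤ M → ∀ M' : ℕ, 2 * M ≤ M' → M' ≤ 4 * M →
      coldDefect r.ρ β M' ≤ 2 ^ 20 * coldDefect r.ρ β M ^ 2 :=
    fun M hM M' h₁ h₂ => coldDefect_sq_le_two_pow r hβ0 M hM M' h₁ h₂
  have hLs : max 8 8 ≤ 16384 * L := by rw [max_self]; omega
  have hex : coldDefect r.ρ β (16384 * L) ≤ 1 / (16 * max (2 ^ 20 : ℝ) 2) := by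
    rw [max_eq_left (by norm_num : (2 : ℝ) ≤ 2 ^ 20)]
    exact h25.trans (by norm_num)
  exact coldPressureAt_of_exit_recursion r hβ0 (by norm_num) hrec hLs hex

end Model

/-- **PX ⇒ IRsc (PROVED; the floor-unit seam, X-free).**  For `β ≥ max β₁ 0` take the pinned 96 %-pure box `L` (`a β·L ≤ T`);
`coldPressureAt_widen_24` gives cold pressure at `2¹⁴L`, so `ξ⋆(β) ≤ 2¹⁴L` (`cpLength_le`) and `a β·ξ⋆(β) ≤ 2¹⁴T < 2¹⁴T + 1`;
the landed rate seam `gapInUnits_of_coldPressure_pinned` concludes `GapInUnits G r a`. -/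
theorem irsc_of_pinnedExit24 (hP : PinnedExitAt (1 / 24)) : IRsc := by
  intro G _ _ _ _ hG hsc
  letI : MeasurableSpace G := borel G
  haveI : BorelSpace G := ⟨rfl⟩
  intro r a ha ha0 hlb
  obtain ⟨T, β₁, hpx⟩ := hP G hG hsc r a ha ha0 hlb
  have key : ∀ β : ℝ, max β₁ 0 ≤ β →
      ∃ L' : ℕ, 1 ≤ L' ∧ a β * (L' : ℝ) ≤ 16384 * T ∧ ColdPressureAt r.ρ β L' := by
    intro β hβ
    have hβ1 : β₁ ≤ β := le_trans (le_max_left _ _) hβ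
    have hβ0 : (0 : ℝ) ≤ β := le_trans (le_max_right _ _) hβ
    obtain ⟨L, hL8, hpin, hδ⟩ := hpx β hβ1
    refine ⟨16384 * L, by omega, ?_, coldPressureAt_widen_24 r hβ0 hL8 hδ⟩
    have : a β * ((16384 * L : ℕ) : ℝ) = 16384 * (a β * (L : ℝ)) := by push_cast; ring
    rw [this]
    linarith
  refine gapInUnits_of_coldPressure_pinned r a ha ha0 (β₂ := max β₁ 0) (fun β hβ => ?_) (T := 16384 * T + 1)
    (β₆ := max β₁ 0) (fun β hβ => ?_)
  · obtain ⟨L', h1, -, h3⟩ := key β hβ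
    exact ⟨L', h1, h3⟩
  · obtain ⟨L', h1, h2, h3⟩ := key β hβ
    have hle : (cpLength r.ρ β : ℝ) ≤ (L' : ℝ) := by exact_mod_cast cpLength_le r.ρ β h1 h3
    have hmul := mul_le_mul_of_nonneg_left hle (ha β).le
    linarith

/-- PX at any tolerance `θ ≤ 1/24` ⇒ IRsc. -/
theorem irsc_of_pinnedExit_le {θ : ℝ} (hθ : θ ≤ 1 / 24) (hP : PinnedExitAt θ) : IRsc :=
  irsc_of_pinnedExit24 fun G _ _ _ _ hG hsc r a ha ha0 hlb => by
    obtain ⟨T, β₁, h⟩ := hP G hG hsc r a ha ha0 hlb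
    exact ⟨T, β₁, fun β hβ => by obtain ⟨L, h8, hp, hd⟩ := h β hβ; exact ⟨L, h8, hp, hd.trans hθ⟩⟩

/-- **The floor-unit bill: `PX → N → IR` BY NAME (PROVED composition; `IR_of_cases` is the tree's).** -/
theorem IR_of (hP : PinnedExitAt (1 / 24)) (hN : IRnsc) : Summit.QuantumFields.YangMills.Theses.BalabanLadder.IR :=
  IR_of_cases (irsc_of_pinnedExit24 hP) hN

/-! ## §3 The H-bill factors through PX, and H is re-based to 96 % (PROVED) -/

/-- **H_θ ⇒ PX_θ (PROVED, every θ).**  At `s := a(β)` (eventually `≤ s₀` since `a → 0`) the floor of `LowerBounds G r a` is exactly H's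
hypothesis; H's window gives a `θ`-pure box `L' ≤ k/a(β)`, i.e. `a(β)·L' ≤ k`: pinned with `T = k`. -/
theorem pinnedExit_of_floorToPurityAt {θ : ℝ} (hH : FloorToPurityAt θ) : PinnedExitAt θ := by
  intro G _ _ _ _ hG hsc
  letI : MeasurableSpace G := borel G
  haveI : BorelSpace G := ⟨rfl⟩
  intro r a ha ha0 hlb
  obtain ⟨⟨v, ε, β₅, Λ₅, hv, hε, hfloor⟩, -⟩ := hlb
  obtain ⟨βH, s₀, k, hs₀, hHβ⟩ := hH G hG hsc r v hv ε Λ₅ hε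
  obtain ⟨βa, hβa⟩ : ∃ βa : ℝ, ∀ β : ℝ, βa ≤ β → a β ≤ s₀ := by
    have hev : ∀ᶠ β in atTop, a β < s₀ := ha0.eventually (gt_mem_nhds hs₀)
    obtain ⟨βa, h⟩ := Filter.eventually_atTop.1 hev
    exact ⟨βa, fun β hβ => (h β hβ).le⟩
  refine ⟨k, max (max β₅ βH) βa, fun β hβ => ?_⟩
  have hβ5 : β₅ ≤ β := le_trans ((le_max_left _ _).trans (le_max_left _ _)) hβ
  have hβH : βH ≤ β := le_trans ((le_max_right _ _).trans (le_max_left _ _)) hβ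
  have hβa' : βa ≤ β := le_trans (le_max_right _ _) hβ
  obtain ⟨L', h8, _h1, h2, h3⟩ := hHβ β hβH (a β) (ha β) (hβa β hβa') (fun L hL => hfloor β hβ5 L hL)
  refine ⟨L', h8, ?_, h3⟩
  have h := (le_div_iff₀ (ha β)).1 h2
  simpa [mul_comm] using h

/-- **`IR_of_H24` — the H-bill at ONE tolerance 96 %: `H_{1/24} → N → IR` BY NAME (PROVED; no R-stub, no `∀ ε₀`).** -/
theorem IR_of_H24 (hH : FloorToPurityAt (1 / 24)) (hN : IRnsc) : Summit.QuantumFields.YangMills.Theses.BalabanLadder.IR :=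
  IR_of (pinnedExit_of_floorToPurityAt hH) hN

/-- H ⇒ H_θ for every `θ > 0` (instantiate `ε₀ := θ`). -/
theorem floorToPurityAt_of_SC {θ : ℝ} (hθ : 0 < θ) (hH : FloorToPuritySC) : FloorToPurityAt θ := by
  intro G _ _ _ _ hG hsc
  letI : MeasurableSpace G := borel G
  haveI : BorelSpace G := ⟨rfl⟩
  intro r v hv ε Λ hε
  exact hH G hG hsc r v hv ε Λ θ hε hθ

section Model

variable {G : Type} [Group G] [TopologicalSpace G] [IsTopologicalGroup G] [CompactSpace G]
  [MeasurableSpace G] [BorelSpace G]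

/-- **Any purity inside an EXPLICIT window (PROVED).**  `β ≥ 0`, `L ≥ 8`, `δᶜ_β(L) ≤ 1/24`, `m ≥ 2` ⇒ `δᶜ_β(m·2¹⁴·L) ≤ e^{−m}`:
widen to `2⁻²⁵ ≤ 2⁻²⁴` at `L'' = 2¹⁴L`, then the landed decay `decay_of_exit` (`δᶜ_β(P) ≤ 2⁻²⁰e^{−(P+1)/L''}` for `P ≥ 2L''`) at `P = m·L''`. -/
theorem coldDefect_window_exp (r : LatticeRep G) {β : ℝ} (hβ0 : 0 ≤ β) {L : ℕ} (hL : 8 ≤ L)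
    (hδ : coldDefect r.ρ β L ≤ 1 / 24) {m : ℕ} (hm : 2 ≤ m) :
    coldDefect r.ρ β (m * (16384 * L)) ≤ Real.exp (-(m : ℝ)) := by
  have h25 := coldDefect_widen_24 r hβ0 L hL hδ
  have h24 : coldDefect r.ρ β (16384 * L) ≤ 1 / 2 ^ 24 := h25.trans (by norm_num)
  have hL'' : 8 ≤ 16384 * L := by omega
  have hdec := decay_of_exit r hβ0 hL'' h24 (m * (16384 * L)) (Nat.mul_le_mul_right _ hm)
  have hLpos : (0 : ℝ) < ((16384 * L : ℕ) : ℝ) := by exact_mod_cast (by omega : 0 < 16384 * L)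
  have hexp : Real.exp (-((((m * (16384 * L) : ℕ) : ℝ) + 1) / ((16384 * L : ℕ) : ℝ))) ≤ Real.exp (-(m : ℝ)) := by
    apply Real.exp_le_exp.mpr
    rw [neg_le_neg_iff, le_div_iff₀ hLpos]
    push_cast
    nlinarith
  have h20 : ((2 : ℝ) ^ 20)⁻¹ ≤ 1 := by norm_num
  calc coldDefect r.ρ β (m * (16384 * L))
      ≤ ((2 : ℝ) ^ 20)⁻¹ * Real.exp (-((((m * (16384 * L) : ℕ) : ℝ) + 1) / ((16384 * L : ℕ) : ℝ))) := hdec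
    _ ≤ 1 * Real.exp (-(m : ℝ)) := by gcongr
    _ = Real.exp (-(m : ℝ)) := one_mul _

end Model

/-- **EXACT RE-BASE OF H (PROVED): `H_{1/24} → FloorToPuritySC`.**  Given `ε₀ > 0` put `m := max 2 ⌈−log ε₀⌉₊` (so `e^{−m} ≤ ε₀`); H₂₄'s
window `[1/s, k/s]` yields a 96 %-pure `L'`; `coldDefect_window_exp` makes `P := m·2¹⁴·L'` `ε₀`-pure, and `1/s ≤ L' ≤ P ≤ (m·2¹⁴·k)/s`:
the window factor becomes `m(ε₀)·2¹⁴·k`, the thresholds `β₀ ↦ max β₀ 0`, `s₀` unchanged. -/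
theorem floorToPuritySC_of_at24 (hH : FloorToPurityAt (1 / 24)) : FloorToPuritySC := by
  intro G _ _ _ _ hG hsc
  letI : MeasurableSpace G := borel G
  haveI : BorelSpace G := ⟨rfl⟩
  intro r v hv ε Λ ε₀ hε hε₀
  obtain ⟨β₀, s₀, k, hs₀, hHβ⟩ := hH G hG hsc r v hv ε Λ hε
  set m : ℕ := max 2 ⌈-Real.log ε₀⌉₊ with hmdef
  have hm2 : 2 ≤ m := le_max_left _ _
  have hexpm : Real.exp (-(m : ℝ)) ≤ ε₀ := by
    rw [← Real.le_log_iff_exp_le hε₀]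
    have h1 : -Real.log ε₀ ≤ (⌈-Real.log ε₀⌉₊ : ℝ) := Nat.le_ceil _
    have h2 : ((⌈-Real.log ε₀⌉₊ : ℕ) : ℝ) ≤ (m : ℝ) := by exact_mod_cast le_max_right _ _
    linarith
  refine ⟨max β₀ 0, s₀, (m : ℝ) * 16384 * k, hs₀, fun β hβ s hs hss hfl => ?_⟩
  have hββ₀ : β₀ ≤ β := le_trans (le_max_left _ _) hβ
  have hβ00 : (0 : ℝ) ≤ β := le_trans (le_max_right _ _) hβ
  obtain ⟨L', h8, h1, h2, h3⟩ := hHβ β hββ₀ s hs hss hfl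
  have hwin := coldDefect_window_exp r hβ00 h8 h3 hm2
  refine ⟨m * (16384 * L'), ?_, ?_, ?_, hwin.trans hexpm⟩
  · calc 8 ≤ L' := h8
      _ ≤ m * (16384 * L') := by nlinarith
  · calc 1 / s ≤ (L' : ℝ) := h1
      _ ≤ ((m * (16384 * L') : ℕ) : ℝ) := by exact_mod_cast (by nlinarith : L' ≤ m * (16384 * L'))
  · have hm0 : (0 : ℝ) ≤ (m : ℝ) * 16384 := by positivity
    have := mul_le_mul_of_nonneg_left h2 hm0
    calc ((m * (16384 * L') : ℕ) : ℝ) = (m : ℝ) * 16384 * (L' : ℝ) := by push_cast; ring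
      _ ≤ (m : ℝ) * 16384 * (k / s) := this
      _ = (m : ℝ) * 16384 * k / s := by ring

/-- **`rebaseH_iff` (PROVED): H at the single tolerance 96 % IS the handshake H of record.** -/
theorem rebaseH_iff : FloorToPurityAt (1 / 24) ↔ FloorToPuritySC :=
  ⟨floorToPuritySC_of_at24, floorToPurityAt_of_SC (by norm_num)⟩

/-- H ⇒ PX at every tolerance `θ > 0` (the H-bill of record factors through the floor-unit node). -/
theorem pinnedExit_of_floorToPuritySC {θ : ℝ} (hθ : 0 < θ) (hH : FloorToPuritySC) : PinnedExitAt θ :=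
  pinnedExit_of_floorToPurityAt (floorToPurityAt_of_SC hθ hH)

end Summit.QuantumFields.YangMills.Cruxes.IR.PinnedExit96

end
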